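import Summits.AnomalousDissipation.AnomalousDissipation.Theses.NeutralTaylorWaves
import Literature.Analysis.FluidPDE.DuchonRobertPressure
import Literature.Analysis.FunctionSpaces.TorusLinearisedNSEnergy

/-!
# Load-bearing analysis of `NeutralTaylorWaves.TaylorWaveQuasiSteady` (stmt-AnomalousDissipation-16293)

Negative lemmas (refuter, crux attack 2026-08-17) for the crux

`TaylorWaveQuasiSteady`: ONE smooth divergence-free mean-zero force `f` on `T³`, `ν_n → 0⁺`, `E`,
`ε₀ > 0`; `∀ K ∃ C ∀ n`: smooth divergence-free mean-zero `w`, smooth `q`, drift `|c| ≤ C` with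
`∫‖w‖² ≤ E`, `|ν_n‖∇w‖₂² − ε₀| ≤ C√ν_n`, `‖(w·∇)w − ν_nΔw + ∇q − c∂₂w − f‖₂² ≤ C ν_n^K`.

Two clauses of the residual are shown to be LOAD-BEARING ("any witness must use them"):

* `taylorWaveQuasiSteady_false_without_convect` — delete the Euler nonlinearity `(w·∇)w` from the
  residual and the statement is FALSE: for the linear (Oseen–Stokes) residual
  `R = −νΔw + ∇q − c∂ᵢw − f` one has the enstrophy identity
  `ν‖Δw‖₂² = −∫⟪R, Δw⟫ − ∫⟪Δf, w⟫` (the pressure and drift pairings `∫⟪∇q,Δw⟫`, `∫⟪∂ᵢw,Δw⟫`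
  vanish), whence `2s·ν‖∇w‖₂² ≤ ‖R‖₂² + ν‖Δf‖₂² + (ν + s²)‖w‖₂²` for every `s ≥ 0`
  (`linear_dissipation_bound`); with `s = √ν` the dissipation is `O(√ν)`, contradicting `ε₀ > 0`.
  Consequently every witness family must have `‖P[(w_n·∇)w_n]‖₂ ≳ ε₀/√E`: shear flows, Beltrami
  modes, exact steady Euler flows and all other "passive" fields are excluded.
* `taylorWaveQuasiSteady_false_without_force` — put `f = 0` and the statement is FALSE: the steady
  energy identity `∫⟪R, w⟫ = ν‖∇w‖₂² − ∫⟪f, w⟫` (`integral_inner_residual_self`, the trilinear and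
  pressure pairings vanish on divergence-free `w`) gives `2s(ν‖∇w‖₂² − ∫⟪f,w⟫) ≤ ‖R‖₂² + s²‖w‖₂²`
  (`dissipation_sub_work_bound`); so the work `∫⟪f, w_n⟫` must tend to `ε₀ > 0`.

All integrations by parts are the tree's torus calculus
(`Literature.Analysis.FunctionSpaces.Torus.integral_inner_partialDeriv_eq_neg`,
`integral_inner_laplacian_comm`, `integral_inner_convect_self_eq_zero`,
`integral_inner_gradient_eq_zero_of_isDivFree`, `integral_inner_laplacian_self_eq_neg_gradNormSq_of_isSmooth`,
`Literature.Analysis.FluidPDE.Torus.partialDeriv_laplacian`, `Literature.Analysis.FluidPDE.Torus.laplacian_gradient`).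
-/

-- `Summit.<Summit>.<Problem>` is the tree's mandated summit-side namespace (CONVENTIONS §2); for this
-- single-conjunct summit the two coincide, so the duplicate is deliberate.
set_option linter.dupNamespace false

noncomputable section

open MeasureTheory Filter Topology
open scoped InnerProductSpace

namespace Summit.AnomalousDissipation.AnomalousDissipation.Theorems.TaylorWaveQuasiSteady.Negative

open Literature.Analysis.FunctionSpaces

variable {d : Type*} [Fintype d] [DecidableEq d]

/-! ## Torus pairings -/

section Pairings

variable {G : Type*} [NormedAddCommGroup G] [InnerProductSpace ℝ G]

/-- Young's inequality for the real inner product: `2 s ⟪a, b⟫ ≤ ‖a‖² + s² ‖b‖²` (`s ≥ 0`). [folklore] -/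
theorem two_mul_mul_inner_le (a b : G) {s : ℝ} (hs : 0 ≤ s) :
    2 * s * ⟪a, b⟫_ℝ ≤ ‖a‖ ^ 2 + s ^ 2 * ‖b‖ ^ 2 := by
  have h1 : ⟪a, b⟫_ℝ ≤ ‖a‖ * ‖b‖ := real_inner_le_norm a b
  have h2 : 2 * ‖a‖ * (s * ‖b‖) ≤ ‖a‖ ^ 2 + (s * ‖b‖) ^ 2 := two_mul_le_add_sq _ _
  nlinarith [norm_nonneg a, norm_nonneg b]

/-- `∫ ⟪∂ᵢ w, w⟫ = 0` for smooth `w` on `T^d`. [folklore] -/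
theorem integral_inner_partialDeriv_self_eq_zero {w : UnitAddTorus d → G} (hw : Torus.IsSmooth w)
    (i : d) : ∫ x, ⟪Torus.partialDeriv i w x, w x⟫_ℝ = 0 := by
  have h := Torus.integral_inner_partialDeriv_eq_neg hw hw i
  have h2 : ∫ x, ⟪w x, Torus.partialDeriv i w x⟫_ℝ = ∫ x, ⟪Torus.partialDeriv i w x, w x⟫_ℝ :=
    integral_congr_ae (ae_of_all _ fun x => real_inner_comm _ _)
  linarith

/-- `∫ ⟪∂ᵢ w, Δ w⟫ = 0` for smooth `w` on `T^d` (Schwarz `∂ᵢΔ = Δ∂ᵢ` and Green symmetry). [folklore] -/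
theorem integral_inner_partialDeriv_laplacian_eq_zero {w : UnitAddTorus d → G}
    (hw : Torus.IsSmooth w) (i : d) :
    ∫ x, ⟪Torus.partialDeriv i w x, Torus.laplacian w x⟫_ℝ = 0 := by
  have h1 := Torus.integral_inner_partialDeriv_eq_neg hw hw.laplacian i
  have h2 : ∫ x, ⟪w x, Torus.partialDeriv i (Torus.laplacian w) x⟫_ℝ =
      ∫ x, ⟪w x, Torus.laplacian (Torus.partialDeriv i w) x⟫_ℝ := by
    simp_rw [Literature.Analysis.FluidPDE.Torus.partialDeriv_laplacian hw]
  have h3 : ∫ x, ⟪w x, Torus.laplacian (Torus.partialDeriv i w) x⟫_ℝ =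
      ∫ x, ⟪Torus.laplacian w x, Torus.partialDeriv i w x⟫_ℝ :=
    (Torus.integral_inner_laplacian_comm hw (hw.partialDeriv i)).symm
  have h4 : ∫ x, ⟪Torus.laplacian w x, Torus.partialDeriv i w x⟫_ℝ =
      ∫ x, ⟪Torus.partialDeriv i w x, Torus.laplacian w x⟫_ℝ :=
    integral_congr_ae (ae_of_all _ fun x => real_inner_comm _ _)
  linarith

/-- `∫ ⟪∇q, Δw⟫ = 0` for smooth `q` and smooth divergence-free `w` on `T^d`
(`Δ∇q = ∇Δq` and `∫⟪∇p, w⟫ = 0`). [folklore] -/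
theorem integral_inner_gradient_laplacian_eq_zero {w : UnitAddTorus d → EuclideanSpace ℝ d}
    {q : UnitAddTorus d → ℝ} (hw : Torus.IsSmooth w) (hq : Torus.IsSmooth q)
    (hdiv : Torus.IsDivFree w) :
    ∫ x, ⟪Torus.gradient q x, Torus.laplacian w x⟫_ℝ = 0 := by
  rw [← Torus.integral_inner_laplacian_comm hq.gradient hw]
  simp_rw [Literature.Analysis.FluidPDE.Torus.laplacian_gradient hq]
  exact Torus.integral_inner_gradient_eq_zero_of_isDivFree hw hq.laplacian hdiv

end Pairings

/-! ## The two balance laws of a steady quasi-solution -/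

section Balance

variable {w f : UnitAddTorus d → EuclideanSpace ℝ d} {q : UnitAddTorus d → ℝ}

/-- **Steady energy identity.** For smooth divergence-free `w`, smooth `q`, `f` and the full
residual `R = (w·∇)w − νΔw + ∇q − c∂ᵢw − f`: `∫⟪R, w⟫ = ν‖∇w‖₂² − ∫⟪f, w⟫` (the trilinear,
pressure and drift pairings vanish). [folklore] -/
theorem integral_inner_residual_self (hw : Torus.IsSmooth w) (hq : Torus.IsSmooth q)
    (hf : Torus.IsSmooth f) (hdiv : Torus.IsDivFree w) (ν c : ℝ) (i : d) :
    ∫ x, ⟪Torus.convect w w x - ν • Torus.laplacian w x + Torus.gradient q x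
        - c • Torus.partialDeriv i w x - f x, w x⟫_ℝ =
      ν * Torus.gradNormSq w - ∫ x, ⟪f x, w x⟫_ℝ := by
  have iC : Integrable (fun x => ⟪Torus.convect w w x, w x⟫_ℝ) volume :=
    ((hw.convect hw).inner hw).integrable
  have iL : Integrable (fun x => ν * ⟪Torus.laplacian w x, w x⟫_ℝ) volume :=
    ((hw.laplacian.inner hw).integrable).const_mul ν
  have iG : Integrable (fun x => ⟪Torus.gradient q x, w x⟫_ℝ) volume :=
    (hq.gradient.inner hw).integrable
  have iP : Integrable (fun x => c * ⟪Torus.partialDeriv i w x, w x⟫_ℝ) volume :=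
    (((hw.partialDeriv i).inner hw).integrable).const_mul c
  have iF : Integrable (fun x => ⟪f x, w x⟫_ℝ) volume := (hf.inner hw).integrable
  have eL : ∫ x, ⟪Torus.laplacian w x, w x⟫_ℝ = -Torus.gradNormSq w :=
    Torus.integral_inner_laplacian_self_eq_neg_gradNormSq_of_isSmooth hw
  have i2 : Integrable (fun x => ⟪Torus.convect w w x, w x⟫_ℝ
      - ν * ⟪Torus.laplacian w x, w x⟫_ℝ) volume := iC.sub iL
  have i3 : Integrable (fun x => ⟪Torus.convect w w x, w x⟫_ℝ
      - ν * ⟪Torus.laplacian w x, w x⟫_ℝ + ⟪Torus.gradient q x, w x⟫_ℝ) volume := i2.add iG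
  have i4 : Integrable (fun x => ⟪Torus.convect w w x, w x⟫_ℝ
      - ν * ⟪Torus.laplacian w x, w x⟫_ℝ + ⟪Torus.gradient q x, w x⟫_ℝ
      - c * ⟪Torus.partialDeriv i w x, w x⟫_ℝ) volume := i3.sub iP
  simp_rw [inner_sub_left, inner_add_left, inner_sub_left, real_inner_smul_left]
  rw [integral_sub i4 iF, integral_sub i3 iP, integral_add i2 iG, integral_sub iC iL,
    integral_const_mul, integral_const_mul,
    Torus.integral_inner_convect_self_eq_zero hw hdiv,
    Torus.integral_inner_gradient_eq_zero_of_isDivFree hw hq hdiv,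
    integral_inner_partialDeriv_self_eq_zero hw i, eL]
  ring

/-- **Energy inequality**: `2s(ν‖∇w‖₂² − ∫⟪f,w⟫) ≤ ‖R‖₂² + s²‖w‖₂²` for every `s ≥ 0`, with
`R` the full steady residual. [folklore] -/
theorem dissipation_sub_work_bound (hw : Torus.IsSmooth w) (hq : Torus.IsSmooth q)
    (hf : Torus.IsSmooth f) (hdiv : Torus.IsDivFree w) (ν c : ℝ) (i : d) {s : ℝ} (hs : 0 ≤ s) :
    2 * s * (ν * Torus.gradNormSq w - ∫ x, ⟪f x, w x⟫_ℝ) ≤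
      (∫ x, ‖Torus.convect w w x - ν • Torus.laplacian w x + Torus.gradient q x
          - c • Torus.partialDeriv i w x - f x‖ ^ 2) + s ^ 2 * ∫ x, ‖w x‖ ^ 2 := by
  set R : UnitAddTorus d → EuclideanSpace ℝ d := fun x => Torus.convect w w x
    - ν • Torus.laplacian w x + Torus.gradient q x - c • Torus.partialDeriv i w x - f x
  have hRs : Torus.IsSmooth R :=
    ((((hw.convect hw).sub (hw.laplacian.smul ν)).add hq.gradient).sub
      ((hw.partialDeriv i).smul c)).sub hf
  have hid : ∫ x, ⟪R x, w x⟫_ℝ = ν * Torus.gradNormSq w - ∫ x, ⟪f x, w x⟫_ℝ :=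
    integral_inner_residual_self hw hq hf hdiv ν c i
  have hpt : ∀ x, 2 * s * ⟪R x, w x⟫_ℝ ≤ ‖R x‖ ^ 2 + s ^ 2 * ‖w x‖ ^ 2 := fun x =>
    two_mul_mul_inner_le (R x) (w x) hs
  have i1 : Integrable (fun x => 2 * s * ⟪R x, w x⟫_ℝ) volume :=
    ((hRs.inner hw).integrable).const_mul (2 * s)
  have i2 : Integrable (fun x => ‖R x‖ ^ 2 + s ^ 2 * ‖w x‖ ^ 2) volume :=
    hRs.norm_sq.integrable.add (hw.norm_sq.integrable.const_mul (s ^ 2))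
  have hmono := integral_mono i1 i2 hpt
  rw [integral_const_mul, integral_add hRs.norm_sq.integrable (hw.norm_sq.integrable.const_mul _),
    integral_const_mul, hid] at hmono
  exact hmono

/-- **Linear enstrophy identity.** For smooth divergence-free `w`, smooth `q`, `f` and the LINEAR
residual `R = −νΔw + ∇q − c∂ᵢw − f` (no convective term):
`ν‖Δw‖₂² = −∫⟪R, Δw⟫ − ∫⟪Δf, w⟫`. [folklore] -/
theorem linear_enstrophy_identity (hw : Torus.IsSmooth w) (hq : Torus.IsSmooth q)
    (hf : Torus.IsSmooth f) (hdiv : Torus.IsDivFree w) (ν c : ℝ) (i : d) :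
    ν * ∫ x, ‖Torus.laplacian w x‖ ^ 2 =
      -(∫ x, ⟪-(ν • Torus.laplacian w x) + Torus.gradient q x - c • Torus.partialDeriv i w x - f x,
          Torus.laplacian w x⟫_ℝ) - ∫ x, ⟪Torus.laplacian f x, w x⟫_ℝ := by
  have iL : Integrable (fun x => ν * ⟪Torus.laplacian w x, Torus.laplacian w x⟫_ℝ) volume :=
    ((hw.laplacian.inner hw.laplacian).integrable).const_mul ν
  have iG : Integrable (fun x => ⟪Torus.gradient q x, Torus.laplacian w x⟫_ℝ) volume :=
    (hq.gradient.inner hw.laplacian).integrable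
  have iP : Integrable (fun x => c * ⟪Torus.partialDeriv i w x, Torus.laplacian w x⟫_ℝ) volume :=
    (((hw.partialDeriv i).inner hw.laplacian).integrable).const_mul c
  have iF : Integrable (fun x => ⟪f x, Torus.laplacian w x⟫_ℝ) volume :=
    (hf.inner hw.laplacian).integrable
  have eF : ∫ x, ⟪f x, Torus.laplacian w x⟫_ℝ = ∫ x, ⟪Torus.laplacian f x, w x⟫_ℝ :=
    (Torus.integral_inner_laplacian_comm hf hw).symm
  have eLL : ∫ x, ⟪Torus.laplacian w x, Torus.laplacian w x⟫_ℝ = ∫ x, ‖Torus.laplacian w x‖ ^ 2 :=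
    integral_congr_ae (ae_of_all _ fun x => real_inner_self_eq_norm_sq _)
  have i1 : Integrable (fun x => -(ν * ⟪Torus.laplacian w x, Torus.laplacian w x⟫_ℝ)) volume :=
    iL.neg
  have i2 : Integrable (fun x => -(ν * ⟪Torus.laplacian w x, Torus.laplacian w x⟫_ℝ)
      + ⟪Torus.gradient q x, Torus.laplacian w x⟫_ℝ) volume := i1.add iG
  have i3 : Integrable (fun x => -(ν * ⟪Torus.laplacian w x, Torus.laplacian w x⟫_ℝ)
      + ⟪Torus.gradient q x, Torus.laplacian w x⟫_ℝ
      - c * ⟪Torus.partialDeriv i w x, Torus.laplacian w x⟫_ℝ) volume := i2.sub iP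
  simp_rw [inner_sub_left, inner_add_left, inner_neg_left, real_inner_smul_left]
  rw [integral_sub i3 iF, integral_sub i2 iP, integral_add i1 iG, integral_neg,
    integral_const_mul, integral_const_mul,
    integral_inner_gradient_laplacian_eq_zero hw hq hdiv,
    integral_inner_partialDeriv_laplacian_eq_zero hw i, eF, eLL]
  ring

/-- **Linear dissipation bound.** Without the convective term, for every `s ≥ 0` and `ν ≥ 0`:
`2s·ν‖∇w‖₂² ≤ ‖R‖₂² + ν‖Δf‖₂² + ν‖w‖₂² + s²‖w‖₂²`, `R = −νΔw + ∇q − c∂ᵢw − f`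
(enstrophy identity, Young, and `ν‖∇w‖₂² = ∫⟪−νΔw, w⟫`). With `s = √ν` the dissipation of a
linear quasi-solution family with `‖R‖₂² = O(ν)` and bounded energy is `O(√ν)`. [folklore] -/
theorem linear_dissipation_bound (hw : Torus.IsSmooth w) (hq : Torus.IsSmooth q)
    (hf : Torus.IsSmooth f) (hdiv : Torus.IsDivFree w) {ν : ℝ} (hν : 0 ≤ ν) (c : ℝ) (i : d)
    {s : ℝ} (hs : 0 ≤ s) :
    2 * s * (ν * Torus.gradNormSq w) ≤
      (∫ x, ‖-(ν • Torus.laplacian w x) + Torus.gradient q x - c • Torus.partialDeriv i w x - f x‖ ^ 2)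
        + ν * (∫ x, ‖Torus.laplacian f x‖ ^ 2) + ν * (∫ x, ‖w x‖ ^ 2)
        + s ^ 2 * (∫ x, ‖w x‖ ^ 2) := by
  set R : UnitAddTorus d → EuclideanSpace ℝ d := fun x =>
    -(ν • Torus.laplacian w x) + Torus.gradient q x - c • Torus.partialDeriv i w x - f x
  have hRs : Torus.IsSmooth R :=
    ((((hw.laplacian.smul ν).neg).add hq.gradient).sub ((hw.partialDeriv i).smul c)).sub hf
  have hL := hw.laplacian
  -- (A) the enstrophy identity
  have hid : ν * ∫ x, ‖Torus.laplacian w x‖ ^ 2 =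
      -(∫ x, ⟪R x, Torus.laplacian w x⟫_ℝ) - ∫ x, ⟪Torus.laplacian f x, w x⟫_ℝ :=
    linear_enstrophy_identity hw hq hf hdiv ν c i
  -- (B) Young: `-2ν⟪R, Δw⟫ ≤ ‖R‖² + ν²‖Δw‖²` and `-2ν⟪Δf, w⟫ ≤ ν(‖Δf‖² + ‖w‖²)`
  have hB1 : ∀ x, -(2 * ν * ⟪R x, Torus.laplacian w x⟫_ℝ) ≤
      ‖R x‖ ^ 2 + ν ^ 2 * ‖Torus.laplacian w x‖ ^ 2 := by
    intro x
    have h := two_mul_mul_inner_le (R x) (-Torus.laplacian w x) hν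
    rw [inner_neg_right, norm_neg] at h
    linarith
  have hB2 : ∀ x, -(2 * ν * ⟪Torus.laplacian f x, w x⟫_ℝ) ≤
      ν * ‖Torus.laplacian f x‖ ^ 2 + ν * ‖w x‖ ^ 2 := by
    intro x
    have h := two_mul_mul_inner_le (Torus.laplacian f x) (-w x) zero_le_one
    rw [inner_neg_right, norm_neg] at h
    nlinarith [h, hν]
  have iB1l : Integrable (fun x => -(2 * ν * ⟪R x, Torus.laplacian w x⟫_ℝ)) volume :=
    (((hRs.inner hL).integrable).const_mul (2 * ν)).neg
  have iB1r : Integrable (fun x => ‖R x‖ ^ 2 + ν ^ 2 * ‖Torus.laplacian w x‖ ^ 2) volume :=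
    hRs.norm_sq.integrable.add (hL.norm_sq.integrable.const_mul _)
  have iB2l : Integrable (fun x => -(2 * ν * ⟪Torus.laplacian f x, w x⟫_ℝ)) volume :=
    (((hf.laplacian.inner hw).integrable).const_mul (2 * ν)).neg
  have iB2r : Integrable (fun x => ν * ‖Torus.laplacian f x‖ ^ 2 + ν * ‖w x‖ ^ 2) volume :=
    (hf.laplacian.norm_sq.integrable.const_mul _).add (hw.norm_sq.integrable.const_mul _)
  have hm1 := integral_mono iB1l iB1r hB1
  have hm2 := integral_mono iB2l iB2r hB2
  rw [integral_neg, integral_const_mul,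
    integral_add hRs.norm_sq.integrable (hL.norm_sq.integrable.const_mul _),
    integral_const_mul] at hm1
  rw [integral_neg, integral_const_mul,
    integral_add (hf.laplacian.norm_sq.integrable.const_mul _) (hw.norm_sq.integrable.const_mul _),
    integral_const_mul, integral_const_mul] at hm2
  -- hence `ν²‖Δw‖² ≤ ‖R‖² + ν‖Δf‖² + ν‖w‖²`
  have hBB : ν ^ 2 * ∫ x, ‖Torus.laplacian w x‖ ^ 2 ≤
      (∫ x, ‖R x‖ ^ 2) + ν * (∫ x, ‖Torus.laplacian f x‖ ^ 2) + ν * ∫ x, ‖w x‖ ^ 2 := by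
    nlinarith [hid, hm1, hm2]
  -- (C) Young: `2s⟪-νΔw, w⟫ ≤ ν²‖Δw‖² + s²‖w‖²`, and `∫⟪-νΔw, w⟫ = ν‖∇w‖²`
  have hC : ∀ x, 2 * s * ⟪-(ν • Torus.laplacian w x), w x⟫_ℝ ≤
      ν ^ 2 * ‖Torus.laplacian w x‖ ^ 2 + s ^ 2 * ‖w x‖ ^ 2 := by
    intro x
    have h := two_mul_mul_inner_le (-(ν • Torus.laplacian w x)) (w x) hs
    rw [norm_neg, norm_smul, mul_pow, Real.norm_eq_abs, sq_abs] at h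
    exact h
  have iCl : Integrable (fun x => 2 * s * ⟪-(ν • Torus.laplacian w x), w x⟫_ℝ) volume :=
    (((hL.smul ν).neg.inner hw).integrable).const_mul (2 * s)
  have iCr : Integrable (fun x => ν ^ 2 * ‖Torus.laplacian w x‖ ^ 2 + s ^ 2 * ‖w x‖ ^ 2) volume :=
    (hL.norm_sq.integrable.const_mul _).add (hw.norm_sq.integrable.const_mul _)
  have hm3 := integral_mono iCl iCr hC
  rw [integral_const_mul,
    integral_add (hL.norm_sq.integrable.const_mul _) (hw.norm_sq.integrable.const_mul _),
    integral_const_mul, integral_const_mul] at hm3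
  have eC : ∫ x, ⟪-(ν • Torus.laplacian w x), w x⟫_ℝ = ν * Torus.gradNormSq w := by
    simp_rw [inner_neg_left, real_inner_smul_left]
    rw [integral_neg, integral_const_mul]
    rw [Torus.integral_inner_laplacian_self_eq_neg_gradNormSq_of_isSmooth hw]
    ring
  rw [eC] at hm3
  linarith

end Balance

/-! ## The negative lemmas -/

/-- **The Euler nonlinearity is load-bearing** [negative lemma for `NeutralTaylorWaves.TaylorWaveQuasiSteady`,
stmt-AnomalousDissipation-16293]: the crux with the convective term `(w·∇)w` deleted from the residual is
FALSE. Proof: `linear_dissipation_bound` with `K = 1`, `s = √ν_n` gives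
`2ν_n‖∇w_n‖₂² ≤ √ν_n (C + ‖Δf‖₂² + 2E)`, while the dissipation clause gives
`ν_n‖∇w_n‖₂² ≥ ε₀ − C√ν_n`; impossible as `ν_n → 0`. Hence any witness family has
`liminf ‖P[(w_n·∇)w_n]‖₂ > 0` (no shear / Beltrami / steady-Euler / Oseen families). [folklore] -/
theorem taylorWaveQuasiSteady_false_without_convect :
    ¬ ∃ f : UnitAddTorus (Fin 3) → EuclideanSpace ℝ (Fin 3),
      Torus.IsSmooth f ∧ Torus.IsDivFree f ∧ Torus.HasZeroMean f ∧
      ∃ (ν : ℕ → ℝ) (E ε₀ : ℝ), (∀ n, 0 < ν n) ∧ Filter.Tendsto ν Filter.atTop (nhds 0) ∧ 0 < ε₀ ∧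
      ∀ K : ℕ, ∃ C : ℝ, ∀ n : ℕ, ∃ (w : UnitAddTorus (Fin 3) → EuclideanSpace ℝ (Fin 3))
        (q : UnitAddTorus (Fin 3) → ℝ) (c : ℝ),
        Torus.IsSmooth w ∧ Torus.IsSmooth q ∧ Torus.IsDivFree w ∧ Torus.HasZeroMean w ∧ |c| ≤ C ∧
        MeasureTheory.integral MeasureTheory.volume (fun x => ‖w x‖ ^ 2) ≤ E ∧
        |ν n * Torus.gradNormSq w - ε₀| ≤ C * Real.sqrt (ν n) ∧
        MeasureTheory.integral MeasureTheory.volume (fun x =>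
          ‖-((ν n) • Torus.laplacian w x) + Torus.gradient q x
            - c • Torus.partialDeriv (2 : Fin 3) w x - f x‖ ^ 2) ≤ C * (ν n) ^ (K : ℕ) := by
  rintro ⟨f, hf, -, -, ν, E, ε₀, hν, hν0, hε₀, hK⟩
  obtain ⟨C, hC⟩ := hK 1
  set F₂ : ℝ := ∫ x, ‖Torus.laplacian f x‖ ^ 2
  have hF₂0 : 0 ≤ F₂ := integral_nonneg fun x => by positivity
  -- constants are nonnegative (from `n = 0`)
  obtain ⟨w₀, q₀, c₀, -, -, -, -, hc₀, hE₀, -, -⟩ := hC 0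
  have hC0 : 0 ≤ C := (abs_nonneg c₀).trans hc₀
  have hE0 : 0 ≤ E := (integral_nonneg fun x => by positivity).trans hE₀
  -- choose `n` with `√ν_n < δ`
  set M : ℝ := 3 * C + F₂ + 2 * E + 1 with hM
  have hMpos : 0 < M := by rw [hM]; linarith
  obtain ⟨δ, hδ, hδM⟩ : ∃ δ : ℝ, 0 < δ ∧ δ * M < 2 * ε₀ :=
    ⟨ε₀ / M, div_pos hε₀ hMpos, by rw [div_mul_cancel₀ _ hMpos.ne']; linarith⟩
  obtain ⟨n, hn⟩ : ∃ n, ν n < δ ^ 2 :=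
    (hν0.eventually (gt_mem_nhds (by positivity))).exists
  obtain ⟨w, q, c, hw, hq, hdiv, -, -, hEn, hDn, hRn⟩ := hC n
  set r : ℝ := Real.sqrt (ν n)
  have hr0 : 0 ≤ r := Real.sqrt_nonneg _
  have hrr : r ^ 2 = ν n := Real.sq_sqrt (hν n).le
  have hrδ : r < δ := (Real.sqrt_lt' hδ).2 hn
  -- the linear dissipation bound with `s = r`
  have hB := linear_dissipation_bound hw hq hf hdiv (hν n).le c (2 : Fin 3) hr0
  have hE' : 0 ≤ ∫ x, ‖w x‖ ^ 2 := integral_nonneg fun x => by positivity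
  rw [pow_one] at hRn
  -- `2 r (ν G) ≤ r² (C + F₂ + 2E)`
  have h1 : 2 * r * (ν n * Torus.gradNormSq w) ≤ r ^ 2 * (C + F₂ + 2 * E) := by
    rw [hrr]
    nlinarith [hB, hRn, hEn, hE', (hν n).le, hF₂0, mul_le_mul_of_nonneg_left hEn (hν n).le,
      mul_le_mul_of_nonneg_left hEn (sq_nonneg r)]
  -- dissipation clause: `ε₀ ≤ ν G + C r`
  have h2 : ε₀ ≤ ν n * Torus.gradNormSq w + C * r := by
    have := (abs_le.1 hDn).1
    linarith
  have hrpos : 0 < r := Real.sqrt_pos.2 (hν n)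
  have h3 : 2 * (ν n * Torus.gradNormSq w) ≤ r * (C + F₂ + 2 * E) := by
    have := h1
    nlinarith [this, hrpos]
  have h4 : 2 * ε₀ ≤ r * M := by rw [hM]; nlinarith [h2, h3, hC0, hr0]
  have h5 : r * M < 2 * ε₀ := by nlinarith [hrδ, hMpos, hr0, hδM]
  linarith

/-- **The force is load-bearing** [negative lemma for `NeutralTaylorWaves.TaylorWaveQuasiSteady`,
stmt-AnomalousDissipation-16293]: with `f = 0` the crux is FALSE (for any `ν_n → 0⁺`): by the steady
energy identity `ν‖∇w‖₂² = ∫⟪R, w⟫ ≤ (‖R‖₂² + s²‖w‖₂²)/(2s)`, and `K = 1`, `s = √ν_n` makes the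
dissipation `O(√ν_n)`. Equivalently, every witness must have work `∫⟪f, w_n⟫ → ε₀ > 0`. [folklore] -/
theorem taylorWaveQuasiSteady_false_without_force :
    ¬ ∃ (ν : ℕ → ℝ) (E ε₀ : ℝ), (∀ n, 0 < ν n) ∧ Filter.Tendsto ν Filter.atTop (nhds 0) ∧ 0 < ε₀ ∧
      ∀ K : ℕ, ∃ C : ℝ, ∀ n : ℕ, ∃ (w : UnitAddTorus (Fin 3) → EuclideanSpace ℝ (Fin 3))
        (q : UnitAddTorus (Fin 3) → ℝ) (c : ℝ),
        Torus.IsSmooth w ∧ Torus.IsSmooth q ∧ Torus.IsDivFree w ∧ Torus.HasZeroMean w ∧ |c| ≤ C ∧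
        MeasureTheory.integral MeasureTheory.volume (fun x => ‖w x‖ ^ 2) ≤ E ∧
        |ν n * Torus.gradNormSq w - ε₀| ≤ C * Real.sqrt (ν n) ∧
        MeasureTheory.integral MeasureTheory.volume (fun x =>
          ‖Torus.convect w w x - (ν n) • Torus.laplacian w x + Torus.gradient q x
            - c • Torus.partialDeriv (2 : Fin 3) w x‖ ^ 2) ≤ C * (ν n) ^ (K : ℕ) := by
  rintro ⟨ν, E, ε₀, hν, hν0, hε₀, hK⟩
  obtain ⟨C, hC⟩ := hK 1
  obtain ⟨w₀, q₀, c₀, -, -, -, -, hc₀, hE₀, -, -⟩ := hC 0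
  have hC0 : 0 ≤ C := (abs_nonneg c₀).trans hc₀
  have hE0 : 0 ≤ E := (integral_nonneg fun x => by positivity).trans hE₀
  set M : ℝ := 3 * C + E + 1 with hM
  have hMpos : 0 < M := by rw [hM]; linarith
  obtain ⟨δ, hδ, hδM⟩ : ∃ δ : ℝ, 0 < δ ∧ δ * M < 2 * ε₀ :=
    ⟨ε₀ / M, div_pos hε₀ hMpos, by rw [div_mul_cancel₀ _ hMpos.ne']; linarith⟩
  obtain ⟨n, hn⟩ : ∃ n, ν n < δ ^ 2 :=
    (hν0.eventually (gt_mem_nhds (by positivity))).exists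
  obtain ⟨w, q, c, hw, hq, hdiv, -, -, hEn, hDn, hRn⟩ := hC n
  set r : ℝ := Real.sqrt (ν n)
  have hr0 : 0 ≤ r := Real.sqrt_nonneg _
  have hrr : r ^ 2 = ν n := Real.sq_sqrt (hν n).le
  have hrδ : r < δ := (Real.sqrt_lt' hδ).2 hn
  have hrpos : 0 < r := Real.sqrt_pos.2 (hν n)
  have hf0 : Torus.IsSmooth (fun _ : UnitAddTorus (Fin 3) => (0 : EuclideanSpace ℝ (Fin 3))) :=
    Torus.isSmooth_const _
  have hB := dissipation_sub_work_bound hw hq hf0 hdiv (ν n) c (2 : Fin 3) hr0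
  simp only [inner_zero_left, integral_zero, sub_zero] at hB
  rw [pow_one] at hRn
  have hE' : 0 ≤ ∫ x, ‖w x‖ ^ 2 := integral_nonneg fun x => by positivity
  have h1 : 2 * r * (ν n * Torus.gradNormSq w) ≤ r ^ 2 * (C + E) := by
    rw [hrr]
    nlinarith [hB, hRn, hEn, hE', mul_le_mul_of_nonneg_left hEn (sq_nonneg r)]
  have h2 : ε₀ ≤ ν n * Torus.gradNormSq w + C * r := by
    have := (abs_le.1 hDn).1
    linarith
  have h3 : 2 * (ν n * Torus.gradNormSq w) ≤ r * (C + E) := by nlinarith [h1, hrpos]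
  have h4 : 2 * ε₀ ≤ r * M := by rw [hM]; nlinarith [h2, h3, hC0, hr0]
  have h5 : r * M < 2 * ε₀ := by nlinarith [hrδ, hMpos, hr0, hδM]
  linarith

end Summit.AnomalousDissipation.AnomalousDissipation.Theorems.TaylorWaveQuasiSteady.Negative

end
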